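import Summits.HubbardSuperconductivity.HubbardSuperconductivity.Theorems.LevyLogBootstrapDressHalfFilledBandStates
import Summits.HubbardSuperconductivity.HubbardSuperconductivity.Theorems.CooperPairDMottWalkCooperPairDMottPairTrialCeilingWindowReduction
import Literature.MathematicalPhysics.QuantumLattice.SectorUniqueGroundStateGap
import HarnessLib

/-!
# Route `LevyLogBootstrap`, crux `DressHalfFilled` (stmt-HubbardSuperconductivity-8148), stub 2
# `stub_plaquetteDictionary`: sector-wise gaps of one plaquette above the hole-pair band

Support file (plaquette level of the exhaustion clause (c) of `PlaquetteDictionary`). For the plaquette Hubbard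
Hamiltonian `h = plaquetteHamiltonian U` and its two band states `|0h⟩ = plaquetteStates U 0` (sector
`(N↑,N↓) = (2,2)`, energy `e₀ = E(0 holes)`) and `|2h⟩ = plaquetteStates U 1` (sector `(1,1)`, energy `e₂`), put
`ℓ(n) = (2e₂ − e₀) + ((e₀ − e₂)/2)·n`, the chord through `(2, e₂)` and `(4, e₀)`. Under the plaquette data (the
clauses (W3)–(W5) of `PlaquetteData U`, here as explicit hypotheses) every coordinate sector `(a, b)`, `a, b ≤ 4`,
is separated from the band by a positive margin:

* `plaquette_inBand_gap_four` / `_two` — in the band sectors `(2,2)`, `(1,1)`: vectors orthogonal to the (unique,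
  (W4)) sector ground state lie at least `γ > 0` above `e₀`, resp. `e₂` (`sector_gap_of_unique_groundState`);
* `plaquette_offBand_gap` — off the band (`a + b ∉ {2, 4}` by the strict chord (W3); `a + b ∈ {2, 4}` with `a ≠ b`
  by the spin-sector inequalities (W5)): `(ℓ(a + b) + δ) ‖u‖² ≤ Re⟨u, h u⟩` for some `δ > 0`.

References: W.-F. Tsai, S. A. Kivelson, PRB 73 (2006) 214510, Table I, App. A; H. Tasaki, *Physics and Mathematics
of Quantum Many-Body Systems* (2020) §2.1–2.2. All statements are [folklore]; no definition is introduced.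
-/

set_option linter.dupNamespace false

noncomputable section

namespace Summit.HubbardSuperconductivity.HubbardSuperconductivity.Theorems.LevyLogBootstrap

open Matrix Finset Literature.MathematicalPhysics.QuantumLattice Literature.Probability.LatticeModels
open Summit.HubbardSuperconductivity.HubbardSuperconductivity.Theorems.CooperPairDMottWalk
open scoped ComplexOrder

/-! ### Homogeneous variational bound in a submodule -/

section Variational

variable {n : Type*} [Fintype n] [DecidableEq n]

/-- `minEnergyOn A K · ‖ψ‖² ≤ Re⟨ψ, A ψ⟩` for every `ψ ∈ K` (normalise `ψ ≠ 0`). [folklore] -/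
theorem minEnergyOn_mul_le_of_mem {A : Matrix n n ℂ} (hA : A.IsHermitian) (K : Submodule ℂ (n → ℂ))
    {ψ : n → ℂ} (hψ : ψ ∈ K) : A.minEnergyOn K * (star ψ ⬝ᵥ ψ).re ≤ (star ψ ⬝ᵥ A *ᵥ ψ).re := by
  by_cases h0 : ψ = 0
  · subst h0
    simp
  obtain ⟨c, hc0, hc1⟩ := exists_smul_unit h0
  have hmem : c • ψ ∈ K := Submodule.smul_mem _ c hψ
  have h2 := minEnergyOn_le_rayleigh_of_mem hA K hmem hc1
  have hcc : star c * c = ((‖c‖ ^ 2 : ℝ) : ℂ) := by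
    rw [Complex.star_def, Complex.conj_mul']
    push_cast
    rfl
  rw [mulVec_smul, star_smul, smul_dotProduct, dotProduct_smul, smul_smul, hcc, smul_eq_mul,
    Complex.re_ofReal_mul] at h2
  rw [star_smul, smul_dotProduct, dotProduct_smul, smul_smul, hcc, smul_eq_mul] at hc1
  have hc1' : ‖c‖ ^ 2 * (star ψ ⬝ᵥ ψ).re = 1 := by
    have := congrArg Complex.re hc1
    rwa [Complex.re_ofReal_mul, Complex.one_re] at this
  have hnn : 0 ≤ (star ψ ⬝ᵥ ψ).re := (Complex.nonneg_iff.1 (dotProduct_star_self_nonneg ψ)).1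
  calc A.minEnergyOn K * (star ψ ⬝ᵥ ψ).re ≤ ‖c‖ ^ 2 * (star ψ ⬝ᵥ A *ᵥ ψ).re * (star ψ ⬝ᵥ ψ).re :=
        mul_le_mul_of_nonneg_right h2 hnn
    _ = (star ψ ⬝ᵥ A *ᵥ ψ).re * (‖c‖ ^ 2 * (star ψ ⬝ᵥ ψ).re) := by ring
    _ = (star ψ ⬝ᵥ A *ᵥ ψ).re := by rw [hc1', mul_one]

end Variational

/-! ### The two band sectors: a unique ground state is gapped -/

section InBand

/-- The plaquette energies of the band states are the sector minima `e₀ = min (4,0)`, `e₂ = min (2,0)`.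
[folklore] -/
theorem plaquetteEnergy_eq_minEnergyOn (U : ℝ) :
    plaquetteEnergy U 0 = (plaquetteHamiltonian U).minEnergyOn (szSector (Λ := PlaquetteSite) 4 0) ∧
      plaquetteEnergy U 2 = (plaquetteHamiltonian U).minEnergyOn (szSector (Λ := PlaquetteSite) 2 0) := by
  constructor
  · simpa using plaquetteEnergy_two_mul U 0
  · simpa using plaquetteEnergy_two_mul U 1

/-- **Gap in a band sector from uniqueness.** If the ground states of `h = plaquetteHamiltonian U` in the joint
sector `(2k, 0)` are unique up to scalars, then for some `γ > 0` every vector of the coordinate sector `(k, k)`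
orthogonal to the band state `plaquetteStates U` (index `2 - k`) satisfies
`(min (2k,0) + γ) ‖u‖² ≤ Re⟨u, h u⟩`. [folklore] -/
theorem plaquette_inBand_gap (U : ℝ) (k : ℕ) (i : Fin 2) (hk : 4 - 2 * (i : ℕ) = 2 * k)
    (hW4 : ∀ φ₁ φ₂ : Fock (Orb PlaquetteSite), IsGroundStateInSector (plaquetteHamiltonian U) (2 * k) 0 φ₁ →
      IsGroundStateInSector (plaquetteHamiltonian U) (2 * k) 0 φ₂ → ∃ a : ℂ, φ₂ = a • φ₁) :
    ∃ γ : ℝ, 0 < γ ∧ ∀ u : Fock (Orb PlaquetteSite), IsInSector k k u →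
      star (plaquetteStates U i) ⬝ᵥ u = 0 →
        ((plaquetteHamiltonian U).minEnergyOn (szSector (Λ := PlaquetteSite) (2 * k) 0) + γ) * (star u ⬝ᵥ u).re ≤
          (star u ⬝ᵥ plaquetteHamiltonian U *ᵥ u).re := by
  set h := plaquetteHamiltonian U with hh
  set s := plaquetteStates U i with hs
  set K := szSector (Λ := PlaquetteSite) (2 * k) 0 with hKdef
  have hA : h.IsHermitian := plaquetteHamiltonian_isHermitian U
  have hPS : PreservesSectors h := LiebThm1.preservesSectors_hamiltonian plaquetteGraph 1 U
  have hsK : s ∈ K := by rw [hs, hKdef, ← hk]; exact (plaquetteStates_spec U i).2.1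
  have hsGS : IsGroundStateInSector h (2 * k) 0 s := by
    have := (plaquetteStates_spec U i).2
    rwa [hk] at this
  have hsSec : IsInSector k k s := (mem_szSector_two_mul_zero_iff k s).1 hsK
  have hs0 : s ≠ 0 := hsGS.2.1
  -- the coordinate predicate of the sector
  have hK : ∀ v : Fock (Orb PlaquetteSite), v ∈ K ↔
      ∀ t, ¬((upPart t).card = k ∧ (downPart t).card = k) → v t = 0 := by
    intro v
    rw [hKdef, mem_szSector_two_mul_zero_iff]
    rfl
  have hp : ∃ t : Finset (Orb PlaquetteSite), (upPart t).card = k ∧ (downPart t).card = k := by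
    by_contra hne
    apply hs0
    funext t
    exact hsSec t fun ht => hne ⟨t, ht⟩
  have hinv : ∀ t t' : Finset (Orb PlaquetteSite), ¬((upPart t).card = k ∧ (downPart t).card = k) →
      ((upPart t').card = k ∧ (downPart t').card = k) → h t t' = 0 := by
    intro t t' ht ht'
    by_contra hne
    exact ht (by rw [(hPS t t' hne).1, (hPS t t' hne).2]; exact ht')
  have huniq : ∀ v ∈ K, ∀ w ∈ K, v ≠ 0 → h *ᵥ v = ((h.minEnergyOn K : ℝ) : ℂ) • v →
      h *ᵥ w = ((h.minEnergyOn K : ℝ) : ℂ) • w → ∃ c : ℂ, w = c • v := by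
    intro v hv w hw hv0 hAv hAw
    by_cases hw0 : w = 0
    · exact ⟨0, by rw [hw0, zero_smul]⟩
    · exact hW4 v w ⟨hv, hv0, hAv⟩ ⟨hw, hw0, hAw⟩
  obtain ⟨γ, hγ, hgap⟩ := sector_gap_of_unique_groundState h hA
    (fun t : Finset (Orb PlaquetteSite) => (upPart t).card = k ∧ (downPart t).card = k) hp hinv K hK huniq
  refine ⟨γ, hγ, fun u hu horth => hgap u ((hK u).2 hu) fun g hg hAg => ?_⟩
  -- every ground state in the sector is a multiple of `s`
  by_cases hg0 : g = 0
  · rw [hg0, star_zero, zero_dotProduct]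
  · obtain ⟨c, rfl⟩ := hW4 s g hsGS ⟨hg, hg0, hAg⟩
    rw [star_smul, smul_dotProduct, horth, smul_zero]

/-- Band sector `(2,2)` (no hole): gap above `e₀` for vectors orthogonal to `|0h⟩`, from (W4) at `(4,0)`.
[folklore] -/
theorem plaquette_inBand_gap_four (U : ℝ)
    (hW4 : ∀ φ₁ φ₂ : Fock (Orb PlaquetteSite), IsGroundStateInSector (plaquetteHamiltonian U) 4 0 φ₁ →
      IsGroundStateInSector (plaquetteHamiltonian U) 4 0 φ₂ → ∃ a : ℂ, φ₂ = a • φ₁) :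
    ∃ γ : ℝ, 0 < γ ∧ ∀ u : Fock (Orb PlaquetteSite), IsInSector 2 2 u → star (plaquetteStates U 0) ⬝ᵥ u = 0 →
      (plaquetteEnergy U 0 + γ) * (star u ⬝ᵥ u).re ≤ (star u ⬝ᵥ plaquetteHamiltonian U *ᵥ u).re := by
  rw [(plaquetteEnergy_eq_minEnergyOn U).1]
  exact plaquette_inBand_gap U 2 0 rfl hW4

/-- Band sector `(1,1)` (one hole pair): gap above `e₂` for vectors orthogonal to `|2h⟩`, from (W4) at `(2,0)`.
[folklore] -/
theorem plaquette_inBand_gap_two (U : ℝ)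
    (hW4 : ∀ φ₁ φ₂ : Fock (Orb PlaquetteSite), IsGroundStateInSector (plaquetteHamiltonian U) 2 0 φ₁ →
      IsGroundStateInSector (plaquetteHamiltonian U) 2 0 φ₂ → ∃ a : ℂ, φ₂ = a • φ₁) :
    ∃ γ : ℝ, 0 < γ ∧ ∀ u : Fock (Orb PlaquetteSite), IsInSector 1 1 u → star (plaquetteStates U 1) ⬝ᵥ u = 0 →
      (plaquetteEnergy U 2 + γ) * (star u ⬝ᵥ u).re ≤ (star u ⬝ᵥ plaquetteHamiltonian U *ᵥ u).re := by
  rw [(plaquetteEnergy_eq_minEnergyOn U).2]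
  exact plaquette_inBand_gap U 1 1 rfl hW4

end InBand

/-! ### Off the band: the strict chord and the spin-sector inequalities -/

section OffBand

/-- The `(N, S^z) = (a + b, (a − b)/2)` sector bound: `min · ‖u‖² ≤ Re⟨u, h u⟩` on the coordinate sector
`(a, b)`. [folklore] -/
theorem plaquette_sector_min_le (U : ℝ) {a b : ℕ} {u : Fock (Orb PlaquetteSite)} (hu : IsInSector a b u) :
    (plaquetteHamiltonian U).minEnergyOn (szSector (Λ := PlaquetteSite) (a + b) (((a : ℝ) - b) / 2)) *
        (star u ⬝ᵥ u).re ≤ (star u ⬝ᵥ plaquetteHamiltonian U *ᵥ u).re :=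
  minEnergyOn_mul_le_of_mem (plaquetteHamiltonian_isHermitian U) _ ((mem_szSector_iff_isInSector a b u).2 hu)

/-- The charge bound: `E(a + b) ‖u‖² ≤ Re⟨u, h u⟩` on the coordinate sector `(a, b)`
(`E(n) = groundEnergyAt plaquetteGraph 1 U n`). [folklore] -/
theorem plaquette_charge_min_le (U : ℝ) {a b : ℕ} {u : Fock (Orb PlaquetteSite)} (hu : IsInSector a b u) :
    groundEnergyAt plaquetteGraph 1 U (a + b) * (star u ⬝ᵥ u).re ≤ (star u ⬝ᵥ plaquetteHamiltonian U *ᵥ u).re :=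
  LiebThm1.groundEnergy_mul_norm_le (plaquetteHamiltonian U) hu.isNParticle

/-- **Off-band margin.** Under the strict chord (W3) and the spin-sector inequalities (W5), every coordinate sector
`(a, b) ∉ {(2,2), (1,1)}` with `a, b ≤ 4` lies strictly above the chord: for some `δ > 0`,
`(ℓ(a + b) + δ) ‖u‖² ≤ Re⟨u, h u⟩`, `ℓ(n) = (2e₂ − e₀) + ((e₀ − e₂)/2) n`. [cite: TsaiKivelson2006, Table I] -/
theorem plaquette_offBand_gap (U : ℝ)
    (hW3 : ∀ n : ℕ, n ≤ 8 → n ≠ 2 → n ≠ 4 →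
      (4 - (n : ℝ)) * groundEnergyAt plaquetteGraph 1 U 2 + ((n : ℝ) - 2) * groundEnergyAt plaquetteGraph 1 U 4 <
        2 * groundEnergyAt plaquetteGraph 1 U n)
    (hW5a : ∀ m : ℝ, m = 1 ∨ m = -1 ∨ m = 2 ∨ m = -2 →
      (plaquetteHamiltonian U).minEnergyOn (szSector 4 0) < (plaquetteHamiltonian U).minEnergyOn (szSector 4 m))
    (hW5b : ∀ m : ℝ, m = 1 ∨ m = -1 →
      (plaquetteHamiltonian U).minEnergyOn (szSector 2 0) < (plaquetteHamiltonian U).minEnergyOn (szSector 2 m))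
    {a b : ℕ} (ha : a ≤ 4) (hb : b ≤ 4) (hab : (a, b) ≠ (2, 2)) (hab' : (a, b) ≠ (1, 1)) :
    ∃ δ : ℝ, 0 < δ ∧ ∀ u : Fock (Orb PlaquetteSite), IsInSector a b u →
      ((2 * plaquetteEnergy U 2 - plaquetteEnergy U 0) + (plaquetteEnergy U 0 - plaquetteEnergy U 2) / 2 * ((a + b : ℕ) : ℝ) + δ) *
          (star u ⬝ᵥ u).re ≤ (star u ⬝ᵥ plaquetteHamiltonian U *ᵥ u).re := by
  have he0 : plaquetteEnergy U 0 = groundEnergyAt plaquetteGraph 1 U 4 := rfl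
  have he2 : plaquetteEnergy U 2 = groundEnergyAt plaquetteGraph 1 U 2 := rfl
  have hnn : ∀ u : Fock (Orb PlaquetteSite), 0 ≤ (star u ⬝ᵥ u).re :=
    fun u => (Complex.nonneg_iff.1 (dotProduct_star_self_nonneg u)).1
  by_cases hn : a + b = 2 ∨ a + b = 4
  · -- spin sectors of the band charges
    set e := (plaquetteHamiltonian U).minEnergyOn (szSector (Λ := PlaquetteSite) (a + b) (((a : ℝ) - b) / 2)) with he
    have hlt : (2 * plaquetteEnergy U 2 - plaquetteEnergy U 0) +
        (plaquetteEnergy U 0 - plaquetteEnergy U 2) / 2 * ((a + b : ℕ) : ℝ) < e := by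
      rcases hn with h2 | h4
      · have hm : ((a : ℝ) - b) / 2 = 1 ∨ ((a : ℝ) - b) / 2 = -1 := by
          have : (a = 2 ∧ b = 0) ∨ (a = 0 ∧ b = 2) := by
            rcases Nat.lt_or_ge a 1 with h | h <;> rcases Nat.lt_or_ge a 2 with h' | h' <;>
              first | omega | (exfalso; exact hab' (by congr 1 <;> omega))
          rcases this with ⟨rfl, rfl⟩ | ⟨rfl, rfl⟩ <;> norm_num
        have h5 := hW5b _ hm
        rw [(plaquetteEnergy_eq_minEnergyOn U).2.symm] at h5
        rw [he, h2]
        push_cast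
        linarith
      · have hm : ((a : ℝ) - b) / 2 = 1 ∨ ((a : ℝ) - b) / 2 = -1 ∨ ((a : ℝ) - b) / 2 = 2 ∨ ((a : ℝ) - b) / 2 = -2 := by
          have : (a = 3 ∧ b = 1) ∨ (a = 1 ∧ b = 3) ∨ (a = 4 ∧ b = 0) ∨ (a = 0 ∧ b = 4) := by
            rcases Nat.lt_or_ge a 1 with h | h <;> rcases Nat.lt_or_ge a 2 with h' | h' <;>
              rcases Nat.lt_or_ge a 3 with h'' | h'' <;> rcases Nat.lt_or_ge a 4 with h''' | h''' <;>
              first | omega | (exfalso; exact hab (by congr 1 <;> omega))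
          rcases this with ⟨rfl, rfl⟩ | ⟨rfl, rfl⟩ | ⟨rfl, rfl⟩ | ⟨rfl, rfl⟩ <;> norm_num
        have h5 := hW5a _ hm
        rw [(plaquetteEnergy_eq_minEnergyOn U).1.symm] at h5
        rw [he, h4]
        push_cast
        linarith
    refine ⟨e - ((2 * plaquetteEnergy U 2 - plaquetteEnergy U 0) +
      (plaquetteEnergy U 0 - plaquetteEnergy U 2) / 2 * ((a + b : ℕ) : ℝ)), by linarith, fun u hu => ?_⟩
    have := plaquette_sector_min_le U hu
    rw [← he] at this
    convert this using 2
    ring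
  · -- other charges: the strict chord
    have hn2 : a + b ≠ 2 := fun h => hn (Or.inl h)
    have hn4 : a + b ≠ 4 := fun h => hn (Or.inr h)
    have h8 : a + b ≤ 8 := by omega
    have h3 := hW3 (a + b) h8 hn2 hn4
    rw [← he0, ← he2] at h3
    set E := groundEnergyAt plaquetteGraph 1 U (a + b) with hE
    have hlt : (2 * plaquetteEnergy U 2 - plaquetteEnergy U 0) +
        (plaquetteEnergy U 0 - plaquetteEnergy U 2) / 2 * ((a + b : ℕ) : ℝ) < E := by
      push_cast at h3 ⊢
      linarith
    refine ⟨E - ((2 * plaquetteEnergy U 2 - plaquetteEnergy U 0) +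
      (plaquetteEnergy U 0 - plaquetteEnergy U 2) / 2 * ((a + b : ℕ) : ℝ)), by linarith, fun u hu => ?_⟩
    have := plaquette_charge_min_le U hu
    rw [← hE] at this
    convert this using 2
    ring

end OffBand

/-! ### Registered form -/

/-- **Registered sub-goal `dressHalfFilled_plaquetteOffBandGap`** (closed form, as registered on the crux item
stmt-HubbardSuperconductivity-8148): under the strict chord (W3) and the spin-sector inequalities (W5) of the plaquette
data, every coordinate sector `(a, b) ∉ {(2,2), (1,1)}`, `a, b ≤ 4`, of one plaquette lies strictly above the chord
`ℓ(a + b)` through the two band levels. [cite: TsaiKivelson2006, Table I] -/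
theorem dressHalfFilled_plaquetteOffBandGap : ∀ (U : ℝ), (∀ n : ℕ, n ≤ 8 → n ≠ 2 → n ≠ 4 → (4 - (n : ℝ)) * groundEnergyAt plaquetteGraph 1 U 2 + ((n : ℝ) - 2) * groundEnergyAt plaquetteGraph 1 U 4 < 2 * groundEnergyAt plaquetteGraph 1 U n) → (∀ m : ℝ, m = 1 ∨ m = -1 ∨ m = 2 ∨ m = -2 → (plaquetteHamiltonian U).minEnergyOn (szSector 4 0) < (plaquetteHamiltonian U).minEnergyOn (szSector 4 m)) → (∀ m : ℝ, m = 1 ∨ m = -1 → (plaquetteHamiltonian U).minEnergyOn (szSector 2 0) < (plaquetteHamiltonian U).minEnergyOn (szSector 2 m)) → ∀ {a b : ℕ}, a ≤ 4 → b ≤ 4 → (a, b) ≠ (2, 2) → (a, b) ≠ (1, 1) → ∃ δ : ℝ, 0 < δ ∧ ∀ u : Fock (Orb PlaquetteSite), IsInSector a b u → ((2 * plaquetteEnergy U 2 - plaquetteEnergy U 0) + (plaquetteEnergy U 0 - plaquetteEnergy U 2) / 2 * ((a + b : ℕ) : ℝ) + δ) * (star u ⬝ᵥ u).re ≤ (star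 u ⬝ᵥ plaquetteHamiltonian U *ᵥ u).re :=
  fun U hW3 hW5a hW5b _ _ ha hb hab hab' => plaquette_offBand_gap U hW3 hW5a hW5b ha hb hab hab'

end Summit.HubbardSuperconductivity.HubbardSuperconductivity.Theorems.LevyLogBootstrap

end
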